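import Summits.CriticalPhenomena.PercolationContinuityZ3.Theorems.PercNearOneGluingNoHeavyLowerTailSunflowerMultiPetalClutterPendant
import Summits.CriticalPhenomena.PercolationContinuityZ3.Theorems.PercNearOneGluingNoHeavyLowerTailSunflowerMultiPetalCompleting
import HarnessLib
import HarnessLib.Audit

/-!
# `NoHeavyLowerTail` (crux stmt-CriticalPhenomena-4575), abstract sunflower cubic, `k` petals: ★ₖ for the coloured clutter of every set family with a
# COVERING POINT — for graphs: every graph having a vertex whose non-neighbours form an independent set (cones, split / threshold / co-chordal /
# complete multipartite graphs)

Support file (seat `prim-l12-p2` gen 36; `--supports stmt-CriticalPhenomena-4575`; a corollary of `MSunflower.ZK_nonneg_of_petalCompleting` (p340984, gen 26)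
for the clutter structure `MSunflower.ofClutter` (p377908, gen 35)).  No `sorry`; nothing is asserted about the crux.
Memo: run/shared/lean/prim/prim-l12/prim-l12-p2/FINDING-g36-BOTTOM-SPECTATOR.md (§HONEST LABEL, §3).

OBSERVATION (this work).  A point `v` COVERS the family `E : Fin k → Finset α` if every edge avoiding `v` contains `E j ∖ {v}` for some edge `E j ∋ v`.  Then `v` is a
petal-completing coordinate of `ofClutter E`: a petal set `X ∌ v` contains exactly the edges of one colour, among them some `E i ∌ v`; the edge `E j ∋ v` with
`E j ∖ {v} ⊆ E i ⊆ X` lies inside `insert v X` and differs from `E i`, so `insert v X` is a kernel set.  Hence `0 ≤ ZK (ofClutter E)` by p340984 — no induction needed.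
For the edge family of a finite simple GRAPH, `v` covers iff every edge of `G − v` has an end-point adjacent to `v`, i.e. iff `V ∖ N[v]` is an INDEPENDENT set.  So ★ₖ holds
for the coloured clutter of every graph with such a vertex: every CONE `H + v` (wheels, fans, windmills, `K_n`, …), every SPLIT graph (a clique vertex covers), every
THRESHOLD graph, every CO-CHORDAL graph (a simplicial vertex of the complement covers), every COMPLETE MULTIPARTITE graph (any vertex covers) — for all sizes; this
supersedes the closed-form / finite computations of FINDING-g35 §2c–2d for ★ₖ (the pencil positivity statements there are a different matter) and makes the 'apex
lemma' unnecessary as a route to ★ₖ of cones.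

* `MSunflower.ofClutter_petalCompleting_of_cover` — a covering point is petal-completing.
* `MSunflower.ZK_nonneg_ofClutter_of_cover` — **★ₖ for every family with a covering point**.
-/

namespace Summit.CriticalPhenomena.PercolationContinuityZ3.Theorems.SunflowerPartition

open Finset

variable {α : Type*} [DecidableEq α] [Fintype α] {k : ℕ}

namespace MSunflower

variable (E : Fin k → Finset α)

/-- **A covering point is a petal-completing coordinate** (this work): if every edge avoiding `v` contains `E j ∖ {v}` for some edge `E j ∋ v`, then
`insert v X` is a kernel set for every petal set `X ∌ v` of `ofClutter E`. [this work] -/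
theorem ofClutter_petalCompleting_of_cover (v : α) (hcov : ∀ i, v ∉ E i → ∃ j, v ∈ E j ∧ (E j).erase v ⊆ E i) :
    ∀ X : Finset α, v ∉ X → X ∉ (ofClutter E).A → (∃ i, X ∈ (ofClutter E).V i) → insert v X ∈ (ofClutter E).A := by
  intro X hvX hXA ⟨i, hXi⟩
  have hEi : E i ⊆ X := by
    rcases (mem_ofClutter_V E).1 hXi with h | h
    · exact h
    · exact absurd ((mem_ofClutter_A E).2 h) hXA
  have hvi : v ∉ E i := fun h => hvX (hEi h)
  obtain ⟨j, hvj, hji⟩ := hcov i hvi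
  have hij : i ≠ j := by
    intro h
    rw [h] at hvi
    exact hvi hvj
  refine (mem_ofClutter_A E).2 ⟨i, j, hij, hEi.trans (subset_insert v X), ?_⟩
  intro x hx
  by_cases hxv : x = v
  · rw [hxv]; exact mem_insert_self v X
  · exact mem_insert_of_mem (hEi (hji (mem_erase.2 ⟨hxv, hx⟩)))

/-- **★ₖ FOR EVERY FAMILY WITH A COVERING POINT** (this work) — for the edge family of a graph: for every graph having a vertex `v` with
`V ∖ N[v]` independent (cones, split, threshold, co-chordal, complete multipartite graphs, …). [this work] -/
theorem ZK_nonneg_ofClutter_of_cover (v : α) (hcov : ∀ i, v ∉ E i → ∃ j, v ∈ E j ∧ (E j).erase v ⊆ E i) :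
    0 ≤ (ofClutter E).ZK :=
  (ofClutter E).ZK_nonneg_of_petalCompleting v (ofClutter_petalCompleting_of_cover E v hcov)

end MSunflower

end Summit.CriticalPhenomena.PercolationContinuityZ3.Theorems.SunflowerPartition
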